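import Summits.BirchSwinnertonDyer.BirchSwinnertonDyer.Theses.BiquadraticEisensteinDescent

/-!
# Sketch (crux-ideate seat 2, g25) — first lemmas for card `sifted-variance-twist-census`

BSD is not proved by this; `HeegnerTwistCouplingInSupply` (stmt-21381) is NOT closed.  Rung-level,
CELL-FREE census for the `j = 8000` corner `W = B_m : y² = x³ + 4m x² + 2m² x` (quadratic twist of
`B₁` by `m`): averaging over the MODULUS `m` (sifted integers, primes included by counting) of the
Heegner-window first moment `S m y = Σ_{d ∈ D(m,y)} L(B_m^{(d)}, 1)` and of its square.  No `sorry`.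
-/

namespace Summit.BirchSwinnertonDyer.BirchSwinnertonDyer.Cruxes.HeegnerTwistCouplingInSupply.SiftedVarianceCensus

open scoped Classical
open Literature.NumberTheory.EllipticCurves

/-- The `√2`-corner curve `B_m : y² = x³ + 4m x² + 2m² x` (for prime `m = p ≡ 5, 7 (8)` this is the
crux's `W` with `j = 8000`, CM by `ℤ[√-2]`, additive and CM-inert at `p`). -/
def Bp (m : ℕ) : WeierstrassCurve ℚ := ⟨0, 4 * m, 0, 2 * m ^ 2, 0⟩

/-- `|L(B_m^{(d)}, 1)|` through the tree's entire L-function (as in the crux conclusion). -/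
noncomputable def Lval (m : ℕ) (d : ℤ) : ℝ := ‖((Bp m).quadraticTwist (d : ℚ)).entireLFunction 1‖

/-- Heegner window: fundamental `d ∈ [-y, -7]` with `d ≡ 1 (8)` and `(d/q) = 1` for every prime
`q ∣ m` (for `m = p` prime: `2` and `p` split in `ℚ(√d)`, i.e. the Heegner hypothesis for `N(B_p) = 2^a p²`). -/
noncomputable def Dset (m y : ℕ) : Finset ℤ :=
  (Finset.Icc (-(y : ℤ)) (-7)).filter (fun d =>
    (∃ (K : Type) (_ : Field K) (_ : NumberField K), IsImaginaryQuadratic K ∧ NumberField.discr K = d) ∧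
    d % 8 = 1 ∧ ∀ q : ℕ, q.Prime → q ∣ m → jacobiSym d q = 1)

/-- Heegner-window first moment for the modulus `m`. -/
noncomputable def S (m y : ℕ) : ℝ := ∑ d ∈ Dset m y, Lval m d

/-- The window `y = (log₂ Q)³` — polylogarithmic, so `h(d) < p` is automatic for `p > Q^{1/8}`. -/
def window (Q : ℕ) : ℕ := Nat.log 2 Q ^ 3

/-- Sifted moduli: squarefree `m ≤ Q`, `m ≡ 7 (16)` (the CELL-LESS rank-one class of the `B_p`
corner, J8000-FIFTEEN §2 / N2), all prime factors `> Q^{1/8}`; contains every prime `p ≡ 7 (16)` in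
`(Q^{1/8}, Q]` and has `≍ Q / log Q` elements. -/
noncomputable def sifted (Q : ℕ) : Finset ℕ :=
  (Finset.Icc 1 Q).filter (fun m => m % 16 = 7 ∧ Squarefree m ∧
    ∀ q : ℕ, q.Prime → q ∣ m → Nat.sqrt (Nat.sqrt (Nat.sqrt Q)) < q)

/-- ★ FIRST LEMMA (the analytic input, K1+K2 of the card): first and second moment of the
NORMALISED window moment `S m y / (A · #D(m,y))` over the sifted moduli, both with relative error
`o(1)` — Iwaniec/Shen first moment and a Soundararajan–Young/X. Li (arXiv:2208.07343, Thm 1.1,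
unconditional) MIXED second moment, carried over the sieve-weighted two-parameter family
`{χ_{m d}}`; `A > 0` is the first-moment constant of `f_{B₁}`. -/
def SiftedMoments (A : ℝ) : Prop :=
  ∀ ε : ℝ, 0 < ε → ∃ Q₀ : ℕ, ∀ Q : ℕ, Q₀ ≤ Q →
    |∑ m ∈ sifted Q, (S m (window Q) / (A * (Dset m (window Q)).card) - 1)| ≤ ε * (sifted Q).card ∧
    ∑ m ∈ sifted Q, (S m (window Q) / (A * (Dset m (window Q)).card)) ^ 2 ≤ (1 + ε) * (sifted Q).card

/-- The census (output): for all but `o(π(Q))` primes `p ≤ Q`, `p ≡ 7 (16)`, some Heegner `d` with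
`|d| ≤ (log₂ Q)³` has `L(B_p^{(d)}, 1) ≠ 0` (then `p ∤ h(d)` by size and the crux conclusion holds
for `W = B_p`, cf. `classNumber_lt_of_natAbs_discr_lt_six_mul`). -/
def CellFreeCensus : Prop :=
  ∀ ε : ℝ, 0 < ε → ∃ Q₀ : ℕ, ∀ Q : ℕ, Q₀ ≤ Q →
    ((((Finset.Icc 1 Q).filter (fun p => p.Prime ∧ p % 16 = 7 ∧
        ∀ d ∈ Dset p (window Q), Lval p d = 0)).card : ℝ)) ≤ ε * Q / Real.log Q

/-- Glue (Chebyshev: an exceptional modulus contributes `(0 - 1)² = 1` to the variance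
`Σ (S/M - 1)² = Σ (S/M)² - 2 Σ (S/M - 1) - #sifted ≤ 3ε · #sifted`, primes `> Q^{1/8}` lie in the
sifted set, `#sifted ≍ Q / log Q`).  Bookkeeping, S-sized. -/
def CensusOfMoments : Prop := (∃ A : ℝ, 0 < A ∧ SiftedMoments A) → CellFreeCensus

/-- Sanity: the variance is termwise at least the indicator of the exceptional moduli. -/
theorem one_le_sq_of_eq_zero {s M : ℝ} (hs : s = 0) : (1 : ℝ) ≤ (s / M - 1) ^ 2 := by
  subst hs; norm_num

end Summit.BirchSwinnertonDyer.BirchSwinnertonDyer.Cruxes.HeegnerTwistCouplingInSupply.SiftedVarianceCensus
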